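import Literature.MathematicalPhysics.QuantumLattice.FrozenEnvironmentEmbedding
import HarnessLib

/-!
# Compression of one- and two-body operator strings to a frozen-environment block

Topic `Literature/MathematicalPhysics/QuantumLattice`; continues `FrozenEnvironmentEmbedding.lean` (the
isometry `V_K = frozenEmbed e K : 𝔉(ι) → 𝔉(ι')` along an order embedding `e : ι ↪o ι'`, environment
orbitals of `K` occupied, the other environment orbitals empty). For the normal-ordered strings
`c†_a c_d` and `c†_a c†_b c_c c_d` of a general second-quantised Hamiltonian
`Σ h_ad c†_a c_d + ½ Σ (ad|bc) c†_a c†_b c_c c_d` (Helgaker–Jørgensen–Olsen (2000) eq. (1.4.39)) this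
file PROVES the compression `V_Kᴴ (string) V_K` for every distribution of the letters over IMAGE
orbitals (`I`, an `e i`) and ENVIRONMENT orbitals (`E`), named by the pattern in string order:
one body `II ↦ c†_i c_j`, `IE, EI ↦ 0`, `EE ↦ [m = m' ∈ K]·1`; two body, six live patterns — `IIII`
(pulled back), Coulomb-type `EIIE`, `IEEI` (`↦ [m = m' ∈ K] c†c`), exchange-type `EIEI`, `IEIE`
(`↦ -[m = m' ∈ K] c†c`) and `EEEE` (the two-electron density matrix of the occupation vector `|K⟩`,
HJO (1.7.33)) — and ten dead ones `IIIE, IIEI, IEII, EIII, IIEE, EEII, EEIE, EIEE, EEEI, IEEE ↦ 0`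
(an unpaired environment letter, or a pairing that cannot return to the block) — the "projections"
behind the frozen-core Hamiltonian (Koridon et al. 2021 App. A; HJO §12.5.1); summed form:
`FrozenEnvironmentCompression.lean`; molecular specialisation: `QuantumChemistry/FrozenCoreHamiltonian.lean`.
All PROVED from the three compression rules of `FrozenEnvironmentEmbedding.lean` and the CAR; 0 sorry, no def.

References: T. Helgaker, P. Jørgensen, J. Olsen, *Molecular Electronic-Structure Theory* (Wiley 2000),
eqs. (1.4.39), (1.7.17), (1.7.33), (12.5.12), (12.5.16) [HelgakerJorgensenOlsen2000]; E. Koridon et al.,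
Phys. Rev. Research 3 (2021) 033127, App. A (A1)–(A6) [KoridonEtAl2021]; O. Bratteli, D. W. Robinson,
*Operator Algebras and Quantum Statistical Mechanics 2* (1997) §5.2.1–5.2.2 [BratteliRobinsonII1997].
-/

noncomputable section

namespace Literature.MathematicalPhysics.QuantumLattice

open Matrix Finset JWEmbed

variable {ι ι' : Type*} [LinearOrder ι] [LinearOrder ι'] [Fintype ι] [Fintype ι']
variable (e : ι ↪o ι') {K : Finset ι'}

omit [Fintype ι] in
/-- `c_a c_b = -c_b c_a` (private copy of a CAR identity). [folklore] -/
private theorem annihilation_swap_eq_neg (a b : ι') :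
    annihilation a * annihilation b = -(annihilation b * annihilation a) :=
  eq_neg_of_add_eq_zero_left (annihilation_anticommute_holds a b)

omit [Fintype ι] in
/-- `c†_a c_b = -c_b c†_a` for `a ≠ b` (private copy of a CAR identity). [folklore] -/
private theorem creation_annihilation_swap_eq_neg {a b : ι'} (h : a ≠ b) :
    creation a * annihilation b = -(annihilation b * creation a) := by
  rw [annihilation_mul_creation, if_neg (Ne.symm h), zero_sub, neg_neg]

omit [Fintype ι'] in
/-- An image orbital is not an environment orbital. [cite: BratteliRobinsonII1997, §5.2.1 (Fock space 𝔉(𝔥₁ ⊕ 𝔥₂); occupation-number basis)] -/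
theorem apply_ne_of_not_mem_rangeF {m : ι'} (hm : m ∉ rangeF e) (i : ι) : e i ≠ m :=
  fun h => hm (h ▸ apply_mem_rangeF i)

/-- `c†_{e i}` commutes with every environment number operator. [cite: BratteliRobinsonII1997, §5.2.2 (even elements of disjoint regions commute)] -/
theorem commute_creation_apply_numberAt (i : ι) {m : ι'} (hm : m ∉ rangeF e) :
    Commute (creation (e i)) (numberAt m) :=
  commute_creation_numberAt_of_ne (apply_ne_of_not_mem_rangeF e hm i)

/-- `c_{e i}` commutes with every environment number operator. [cite: BratteliRobinsonII1997, §5.2.2 (even elements of disjoint regions commute)] -/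
theorem commute_annihilation_apply_numberAt (i : ι) {m : ι'} (hm : m ∉ rangeF e) :
    Commute (annihilation (e i)) (numberAt m) :=
  commute_annihilation_numberAt_of_ne (apply_ne_of_not_mem_rangeF e hm i)

/-- `II`: `V_Kᴴ (c†_{e i} c_{e j}) V_K = c†_i c_j`. [cite: KoridonEtAl2021, App. A eqs. (A3)-(A4) (the active one-body part)] -/
theorem sandwichOne_II (hK : Disjoint K (rangeF e)) (i j : ι) :
    (frozenEmbed e K)ᴴ * (creation (e i) * annihilation (e j)) * frozenEmbed e K =
      creation i * annihilation j := by
  rw [← jwEmbed_creation, ← jwEmbed_annihilation, ← map_mul,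
    conjTranspose_frozenEmbed_mul_jwEmbed_mul_frozenEmbed e hK]

/-- `IE`: `V_Kᴴ (c†_{e i} c_m) V_K = 0` for an environment orbital `m`. [cite: KoridonEtAl2021, App. A eqs. (A2)-(A3) (projection onto |Φ_frozen Φ_active⟩)] -/
theorem sandwichOne_IE (hK : Disjoint K (rangeF e)) {m : ι'} (hm : m ∉ rangeF e) (i : ι) :
    (frozenEmbed e K)ᴴ * (creation (e i) * annihilation m) * frozenEmbed e K = 0 :=
  sandwich_annihilation_eq_zero e hK hm (commute_creation_apply_numberAt e i hm)

/-- `EI`: `V_Kᴴ (c†_m c_{e j}) V_K = 0` for an environment orbital `m`. [cite: KoridonEtAl2021, App. A eqs. (A2)-(A3) (projection onto |Φ_frozen Φ_active⟩)] -/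
theorem sandwichOne_EI (hK : Disjoint K (rangeF e)) {m : ι'} (hm : m ∉ rangeF e) (j : ι) :
    (frozenEmbed e K)ᴴ * (creation m * annihilation (e j)) * frozenEmbed e K = 0 :=
  sandwich_creation_eq_zero e hK hm (commute_annihilation_apply_numberAt e j hm)

/-- `EE`: `V_Kᴴ (c†_m c_{m'}) V_K = [m = m' ∈ K] · 1` (the one-matrix of the occupation vector `|K⟩`,
`D_PQ = δ_PQ k_P`). [cite: HelgakerJorgensenOlsen2000, eq. (1.7.17)] -/
theorem sandwichOne_EE (hK : Disjoint K (rangeF e)) {m m' : ι'} (hm : m ∉ rangeF e)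
    (hm' : m' ∉ rangeF e) :
    (frozenEmbed e K)ᴴ * (creation m * annihilation m') * frozenEmbed e K =
      if m = m' ∧ m ∈ K then 1 else 0 := by
  have h := sandwich_creation_mul_annihilation e hK hm hm' (Commute.one_left (numberAt m'))
  rw [Matrix.one_mul, Matrix.mul_one, conjTranspose_frozenEmbed_mul_self e hK] at h
  exact h

/-- `IIIE ↦ 0`. [cite: KoridonEtAl2021, App. A eqs. (A2)-(A3) (projection onto |Φ_frozen Φ_active⟩)] -/
theorem sandwichTwo_IIIE (hK : Disjoint K (rangeF e)) {m : ι'} (hm : m ∉ rangeF e) (i k l : ι) :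
    (frozenEmbed e K)ᴴ * (creation (e i) * creation (e k) * annihilation (e l) * annihilation m) *
      frozenEmbed e K = 0 :=
  sandwich_annihilation_eq_zero e hK hm
    (((commute_creation_apply_numberAt e i hm).mul_left (commute_creation_apply_numberAt e k hm)).mul_left
      (commute_annihilation_apply_numberAt e l hm))

/-- `IIEI ↦ 0`. [cite: KoridonEtAl2021, App. A eqs. (A2)-(A3) (projection onto |Φ_frozen Φ_active⟩)] -/
theorem sandwichTwo_IIEI (hK : Disjoint K (rangeF e)) {m : ι'} (hm : m ∉ rangeF e) (i k j : ι) :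
    (frozenEmbed e K)ᴴ * (creation (e i) * creation (e k) * annihilation m * annihilation (e j)) *
      frozenEmbed e K = 0 := by
  rw [Matrix.mul_assoc (creation (e i) * creation (e k)), annihilation_swap_eq_neg,
    Matrix.mul_neg, ← Matrix.mul_assoc, Matrix.mul_neg, Matrix.neg_mul,
    sandwich_annihilation_eq_zero e hK hm
      (((commute_creation_apply_numberAt e i hm).mul_left
        (commute_creation_apply_numberAt e k hm)).mul_left (commute_annihilation_apply_numberAt e j hm)),
    neg_zero]

/-- `IEII ↦ 0`. [cite: KoridonEtAl2021, App. A eqs. (A2)-(A3) (projection onto |Φ_frozen Φ_active⟩)] -/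
theorem sandwichTwo_IEII (hK : Disjoint K (rangeF e)) {m : ι'} (hm : m ∉ rangeF e) (i l j : ι) :
    (frozenEmbed e K)ᴴ * (creation (e i) * creation m * annihilation (e l) * annihilation (e j)) *
      frozenEmbed e K = 0 := by
  rw [creation_mul_creation_eq_neg (e i) m, Matrix.neg_mul, Matrix.neg_mul,
    Matrix.mul_assoc (creation m), Matrix.mul_assoc (creation m), Matrix.mul_neg, Matrix.neg_mul,
    sandwich_creation_eq_zero e hK hm
      (((commute_creation_apply_numberAt e i hm).mul_left
        (commute_annihilation_apply_numberAt e l hm)).mul_left (commute_annihilation_apply_numberAt e j hm)),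
    neg_zero]

/-- `EIII ↦ 0`. [cite: KoridonEtAl2021, App. A eqs. (A2)-(A3) (projection onto |Φ_frozen Φ_active⟩)] -/
theorem sandwichTwo_EIII (hK : Disjoint K (rangeF e)) {m : ι'} (hm : m ∉ rangeF e) (k l j : ι) :
    (frozenEmbed e K)ᴴ * (creation m * creation (e k) * annihilation (e l) * annihilation (e j)) *
      frozenEmbed e K = 0 := by
  rw [Matrix.mul_assoc (creation m), Matrix.mul_assoc (creation m)]
  exact sandwich_creation_eq_zero e hK hm
    (((commute_creation_apply_numberAt e k hm).mul_left
      (commute_annihilation_apply_numberAt e l hm)).mul_left (commute_annihilation_apply_numberAt e j hm))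

/-- `c_m c_m = 0` (private bookkeeping). [folklore] -/
private theorem annihilation_mul_self' (m : ι') : annihilation m * annihilation m = 0 := by
  have h := congr_arg conjTranspose (creation_mul_self m)
  rwa [conjTranspose_mul, creation_conjTranspose, conjTranspose_zero] at h

/-- `IIEE ↦ 0` (two environment annihilators cannot return to the block). [cite: KoridonEtAl2021, App. A eqs. (A2)-(A3) (projection onto |Φ_frozen Φ_active⟩)] -/
theorem sandwichTwo_IIEE (hK : Disjoint K (rangeF e)) {m : ι'} (hm : m ∉ rangeF e) (m' : ι') (i k : ι) :
    (frozenEmbed e K)ᴴ * (creation (e i) * creation (e k) * annihilation m' * annihilation m) *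
      frozenEmbed e K = 0 := by
  by_cases h : m' = m
  · subst h
    rw [Matrix.mul_assoc (creation (e i) * creation (e k)), annihilation_mul_self', Matrix.mul_zero,
      Matrix.mul_zero, Matrix.zero_mul]
  · exact sandwich_annihilation_eq_zero e hK hm
      (((commute_creation_apply_numberAt e i hm).mul_left (commute_creation_apply_numberAt e k hm)).mul_left
        (commute_annihilation_numberAt_of_ne h))

/-- `EEII ↦ 0` (two environment creators). [cite: KoridonEtAl2021, App. A eqs. (A2)-(A3) (projection onto |Φ_frozen Φ_active⟩)] -/
theorem sandwichTwo_EEII (hK : Disjoint K (rangeF e)) {m : ι'} (hm : m ∉ rangeF e) (m' : ι') (l j : ι) :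
    (frozenEmbed e K)ᴴ * (creation m * creation m' * annihilation (e l) * annihilation (e j)) *
      frozenEmbed e K = 0 := by
  by_cases h : m' = m
  · subst h
    rw [creation_mul_self, Matrix.zero_mul, Matrix.zero_mul, Matrix.mul_zero, Matrix.zero_mul]
  · rw [Matrix.mul_assoc (creation m), Matrix.mul_assoc (creation m)]
    exact sandwich_creation_eq_zero e hK hm
      (((commute_creation_numberAt_of_ne h).mul_left (commute_annihilation_apply_numberAt e l hm)).mul_left
        (commute_annihilation_apply_numberAt e j hm))

/-- `EEIE ↦ 0` (two environment creators, one environment annihilator). [cite: KoridonEtAl2021, App. A eqs. (A2)-(A3) (projection onto |Φ_frozen Φ_active⟩)] -/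
theorem sandwichTwo_EEIE (hK : Disjoint K (rangeF e)) {m₁ m₂ m₃ : ι'} (h₁ : m₁ ∉ rangeF e)
    (h₂ : m₂ ∉ rangeF e) (h₃ : m₃ ∉ rangeF e) (l : ι) :
    (frozenEmbed e K)ᴴ * (creation m₁ * creation m₃ * annihilation (e l) * annihilation m₂) *
      frozenEmbed e K = 0 := by
  by_cases h13 : m₁ = m₃
  · subst h13
    rw [creation_mul_self, Matrix.zero_mul, Matrix.zero_mul, Matrix.mul_zero, Matrix.zero_mul]
  by_cases h12 : m₁ = m₂
  · subst h12
    rw [creation_mul_creation_eq_neg m₁ m₃, Matrix.neg_mul, Matrix.neg_mul, Matrix.mul_assoc (creation m₃),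
      Matrix.mul_assoc (creation m₃), Matrix.mul_neg, Matrix.neg_mul,
      sandwich_creation_eq_zero e hK h₃
        (((commute_creation_numberAt_of_ne h13).mul_left (commute_annihilation_apply_numberAt e l h₃)).mul_left
          (commute_annihilation_numberAt_of_ne h13)), neg_zero]
  · rw [Matrix.mul_assoc (creation m₁), Matrix.mul_assoc (creation m₁)]
    exact sandwich_creation_eq_zero e hK h₁
      (((commute_creation_numberAt_of_ne (Ne.symm h13)).mul_left
        (commute_annihilation_apply_numberAt e l h₁)).mul_left (commute_annihilation_numberAt_of_ne (Ne.symm h12)))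

/-- `EIEE ↦ 0` (one environment creator, two environment annihilators). [cite: KoridonEtAl2021, App. A eqs. (A2)-(A3) (projection onto |Φ_frozen Φ_active⟩)] -/
theorem sandwichTwo_EIEE (hK : Disjoint K (rangeF e)) (m₁ : ι') {m₂ m₄ : ι'} (h₂ : m₂ ∉ rangeF e)
    (h₄ : m₄ ∉ rangeF e) (k : ι) :
    (frozenEmbed e K)ᴴ * (creation m₁ * creation (e k) * annihilation m₄ * annihilation m₂) *
      frozenEmbed e K = 0 := by
  by_cases h42 : m₄ = m₂
  · subst h42
    rw [Matrix.mul_assoc (creation m₁ * creation (e k)), annihilation_mul_self', Matrix.mul_zero,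
      Matrix.mul_zero, Matrix.zero_mul]
  by_cases h12 : m₁ = m₂
  · subst h12
    rw [Matrix.mul_assoc (creation m₁ * creation (e k)), annihilation_swap_eq_neg m₄ m₁,
      Matrix.mul_neg, ← Matrix.mul_assoc, Matrix.mul_neg, Matrix.neg_mul,
      sandwich_annihilation_eq_zero e hK h₄
        (((commute_creation_numberAt_of_ne (Ne.symm h42)).mul_left
          (commute_creation_apply_numberAt e k h₄)).mul_left (commute_annihilation_numberAt_of_ne (Ne.symm h42))),
      neg_zero]
  · exact sandwich_annihilation_eq_zero e hK h₂
      (((commute_creation_numberAt_of_ne h12).mul_left (commute_creation_apply_numberAt e k h₂)).mul_left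
        (commute_annihilation_numberAt_of_ne h42))

/-- `EEEI ↦ 0` (two environment creators, one environment annihilator). [cite: KoridonEtAl2021, App. A eqs. (A2)-(A3) (projection onto |Φ_frozen Φ_active⟩)] -/
theorem sandwichTwo_EEEI (hK : Disjoint K (rangeF e)) {m₁ m₃ m₄ : ι'} (h₁ : m₁ ∉ rangeF e)
    (h₃ : m₃ ∉ rangeF e) (h₄ : m₄ ∉ rangeF e) (j : ι) :
    (frozenEmbed e K)ᴴ * (creation m₁ * creation m₃ * annihilation m₄ * annihilation (e j)) *
      frozenEmbed e K = 0 := by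
  by_cases h13 : m₁ = m₃
  · subst h13
    rw [creation_mul_self, Matrix.zero_mul, Matrix.zero_mul, Matrix.mul_zero, Matrix.zero_mul]
  by_cases h14 : m₁ = m₄
  · subst h14
    rw [creation_mul_creation_eq_neg m₁ m₃, Matrix.neg_mul, Matrix.neg_mul, Matrix.mul_assoc (creation m₃),
      Matrix.mul_assoc (creation m₃), Matrix.mul_neg, Matrix.neg_mul,
      sandwich_creation_eq_zero e hK h₃
        (((commute_creation_numberAt_of_ne h13).mul_left (commute_annihilation_numberAt_of_ne h13)).mul_left
          (commute_annihilation_apply_numberAt e j h₃)), neg_zero]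
  · rw [Matrix.mul_assoc (creation m₁), Matrix.mul_assoc (creation m₁)]
    exact sandwich_creation_eq_zero e hK h₁
      (((commute_creation_numberAt_of_ne (Ne.symm h13)).mul_left
        (commute_annihilation_numberAt_of_ne (Ne.symm h14))).mul_left (commute_annihilation_apply_numberAt e j h₁))

/-- `IEEE ↦ 0` (one environment creator, two environment annihilators). [cite: KoridonEtAl2021, App. A eqs. (A2)-(A3) (projection onto |Φ_frozen Φ_active⟩)] -/
theorem sandwichTwo_IEEE (hK : Disjoint K (rangeF e)) (m₃ : ι') {m₂ m₄ : ι'} (h₂ : m₂ ∉ rangeF e)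
    (h₄ : m₄ ∉ rangeF e) (i : ι) :
    (frozenEmbed e K)ᴴ * (creation (e i) * creation m₃ * annihilation m₄ * annihilation m₂) *
      frozenEmbed e K = 0 := by
  by_cases h42 : m₄ = m₂
  · subst h42
    rw [Matrix.mul_assoc (creation (e i) * creation m₃), annihilation_mul_self', Matrix.mul_zero,
      Matrix.mul_zero, Matrix.zero_mul]
  by_cases h32 : m₃ = m₂
  · subst h32
    rw [Matrix.mul_assoc (creation (e i) * creation m₃), annihilation_swap_eq_neg m₄ m₃,
      Matrix.mul_neg, ← Matrix.mul_assoc, Matrix.mul_neg, Matrix.neg_mul,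
      sandwich_annihilation_eq_zero e hK h₄
        (((commute_creation_apply_numberAt e i h₄).mul_left
          (commute_creation_numberAt_of_ne (Ne.symm h42))).mul_left (commute_annihilation_numberAt_of_ne (Ne.symm h42))),
      neg_zero]
  · exact sandwich_annihilation_eq_zero e hK h₂
      (((commute_creation_apply_numberAt e i h₂).mul_left (commute_creation_numberAt_of_ne h32)).mul_left
        (commute_annihilation_numberAt_of_ne h42))

/-- `IIII`: the string is pulled back, `V_Kᴴ (c†_{e i} c†_{e k} c_{e l} c_{e j}) V_K = c†_i c†_k c_l c_j`.
[cite: KoridonEtAl2021, App. A eq. (A4) (the active two-body part)] -/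
theorem sandwichTwo_IIII (hK : Disjoint K (rangeF e)) (i k l j : ι) :
    (frozenEmbed e K)ᴴ * (creation (e i) * creation (e k) * annihilation (e l) * annihilation (e j)) *
      frozenEmbed e K = creation i * creation k * annihilation l * annihilation j := by
  rw [← jwEmbed_creation e i, ← jwEmbed_creation e k, ← jwEmbed_annihilation e l,
    ← jwEmbed_annihilation e j, ← map_mul, ← map_mul, ← map_mul,
    conjTranspose_frozenEmbed_mul_jwEmbed_mul_frozenEmbed e hK]

/-- An environment pair `c†_m c_{m'}` moves past an image annihilator (private bookkeeping). [folklore] -/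
private theorem pair_mul_annihilation_apply {m : ι'} (hm : m ∉ rangeF e) (m' : ι') (j : ι) :
    creation m * annihilation m' * annihilation (e j) = annihilation (e j) * (creation m * annihilation m') := by
  rw [Matrix.mul_assoc, annihilation_swap_eq_neg m' (e j), Matrix.mul_neg, ← Matrix.mul_assoc,
    creation_annihilation_swap_eq_neg (Ne.symm (apply_ne_of_not_mem_rangeF e hm j)), Matrix.neg_mul,
    neg_neg, Matrix.mul_assoc]

/-- `EIIE` (Coulomb type): `V_Kᴴ (c†_m c†_{e k} c_{e l} c_{m'}) V_K = [m = m' ∈ K] · c†_k c_l`.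
[cite: HelgakerJorgensenOlsen2000, eq. (12.5.12) (the Coulomb term 2 g_mnii of the inactive Fock matrix)] -/
theorem sandwichTwo_EIIE (hK : Disjoint K (rangeF e)) {m m' : ι'} (hm : m ∉ rangeF e)
    (hm' : m' ∉ rangeF e) (k l : ι) :
    (frozenEmbed e K)ᴴ * (creation m * creation (e k) * annihilation (e l) * annihilation m') *
      frozenEmbed e K = if m = m' ∧ m ∈ K then creation k * annihilation l else 0 := by
  have hw : creation m * creation (e k) * annihilation (e l) * annihilation m' =
      creation (e k) * annihilation (e l) * (creation m * annihilation m') := by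
    rw [creation_mul_creation_eq_neg m (e k), Matrix.neg_mul, Matrix.neg_mul,
      Matrix.mul_assoc (creation (e k)) (creation m),
      creation_annihilation_swap_eq_neg (Ne.symm (apply_ne_of_not_mem_rangeF e hm l)), Matrix.mul_neg,
      Matrix.neg_mul, neg_neg, ← Matrix.mul_assoc (creation (e k)),
      Matrix.mul_assoc (creation (e k) * annihilation (e l))]
  rw [hw, sandwich_creation_mul_annihilation e hK hm hm'
    ((commute_creation_apply_numberAt e k hm').mul_left (commute_annihilation_apply_numberAt e l hm')),
    sandwichOne_II e hK]

/-- `IEEI` (Coulomb type): `V_Kᴴ (c†_{e i} c†_m c_{m'} c_{e j}) V_K = [m = m' ∈ K] · c†_i c_j`.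
[cite: HelgakerJorgensenOlsen2000, eq. (12.5.12) (the Coulomb term 2 g_mnii of the inactive Fock matrix)] -/
theorem sandwichTwo_IEEI (hK : Disjoint K (rangeF e)) {m m' : ι'} (hm : m ∉ rangeF e)
    (hm' : m' ∉ rangeF e) (i j : ι) :
    (frozenEmbed e K)ᴴ * (creation (e i) * creation m * annihilation m' * annihilation (e j)) *
      frozenEmbed e K = if m = m' ∧ m ∈ K then creation i * annihilation j else 0 := by
  have hw : creation (e i) * creation m * annihilation m' * annihilation (e j) =
      creation (e i) * annihilation (e j) * (creation m * annihilation m') := by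
    rw [Matrix.mul_assoc (creation (e i)), Matrix.mul_assoc (creation (e i)),
      pair_mul_annihilation_apply e hm, ← Matrix.mul_assoc (creation (e i))]
  rw [hw, sandwich_creation_mul_annihilation e hK hm hm'
    ((commute_creation_apply_numberAt e i hm').mul_left (commute_annihilation_apply_numberAt e j hm')),
    sandwichOne_II e hK]

/-- `EIEI` (exchange type): `V_Kᴴ (c†_m c†_{e k} c_{m'} c_{e j}) V_K = -[m = m' ∈ K] · c†_k c_j`.
[cite: HelgakerJorgensenOlsen2000, eq. (12.5.12) (the exchange term -g_miin of the inactive Fock matrix)] -/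
theorem sandwichTwo_EIEI (hK : Disjoint K (rangeF e)) {m m' : ι'} (hm : m ∉ rangeF e)
    (hm' : m' ∉ rangeF e) (k j : ι) :
    (frozenEmbed e K)ᴴ * (creation m * creation (e k) * annihilation m' * annihilation (e j)) *
      frozenEmbed e K = if m = m' ∧ m ∈ K then -(creation k * annihilation j) else 0 := by
  have hw : creation m * creation (e k) * annihilation m' * annihilation (e j) =
      -(creation (e k) * annihilation (e j) * (creation m * annihilation m')) := by
    rw [creation_mul_creation_eq_neg m (e k), Matrix.neg_mul, Matrix.neg_mul,
      Matrix.mul_assoc (creation (e k)) (creation m), Matrix.mul_assoc (creation (e k)),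
      pair_mul_annihilation_apply e hm, ← Matrix.mul_assoc (creation (e k))]
  rw [hw, Matrix.mul_neg, Matrix.neg_mul, sandwich_creation_mul_annihilation e hK hm hm'
    ((commute_creation_apply_numberAt e k hm').mul_left (commute_annihilation_apply_numberAt e j hm')),
    sandwichOne_II e hK]
  split_ifs <;> simp

/-- `IEIE` (exchange type): `V_Kᴴ (c†_{e i} c†_{m'} c_{e l} c_m) V_K = -[m' = m ∈ K] · c†_i c_l`.
[cite: HelgakerJorgensenOlsen2000, eq. (12.5.12) (the exchange term -g_miin of the inactive Fock matrix)] -/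
theorem sandwichTwo_IEIE (hK : Disjoint K (rangeF e)) {m m' : ι'} (hm : m ∉ rangeF e)
    (hm' : m' ∉ rangeF e) (i l : ι) :
    (frozenEmbed e K)ᴴ * (creation (e i) * creation m' * annihilation (e l) * annihilation m) *
      frozenEmbed e K = if m' = m ∧ m' ∈ K then -(creation i * annihilation l) else 0 := by
  have hw : creation (e i) * creation m' * annihilation (e l) * annihilation m =
      -(creation (e i) * annihilation (e l) * (creation m' * annihilation m)) := by
    rw [Matrix.mul_assoc (creation (e i)),
      creation_annihilation_swap_eq_neg (Ne.symm (apply_ne_of_not_mem_rangeF e hm' l)), Matrix.mul_neg,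
      Matrix.neg_mul, ← Matrix.mul_assoc (creation (e i)), Matrix.mul_assoc (creation (e i) * annihilation (e l))]
  rw [hw, Matrix.mul_neg, Matrix.neg_mul, sandwich_creation_mul_annihilation e hK hm' hm
    ((commute_creation_apply_numberAt e i hm).mul_left (commute_annihilation_apply_numberAt e l hm)),
    sandwichOne_II e hK]
  split_ifs <;> simp

/-- `V_Kᴴ n_a V_K = [a ∈ K] · 1` for an environment orbital `a` (private bookkeeping).
[cite: HelgakerJorgensenOlsen2000, eq. (1.7.17)] -/
private theorem sandwich_numberAt (hK : Disjoint K (rangeF e)) {a : ι'} (ha : a ∉ rangeF e) :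
    (frozenEmbed e K)ᴴ * numberAt a * frozenEmbed e K = if a ∈ K then 1 else 0 := by
  rw [numberAt, sandwichOne_EE e hK ha ha]
  simp only [true_and]

/-- `EEEE`: the environment string compresses to the two-electron density matrix of the occupation
vector `|K⟩`: `V_Kᴴ (c†_{m₁} c†_{m₃} c_{m₄} c_{m₂}) V_K = ([m₃ = m₄][m₁ = m₂] - [m₁ = m₄][m₃ = m₂]) [m₁, m₃ ∈ K] · 1`
(`T_{PQ,RS} = k_P k_Q (δ_PR δ_QS - δ_PS δ_QR)`). [cite: HelgakerJorgensenOlsen2000, eq. (1.7.33)] -/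
theorem sandwichTwo_EEEE (hK : Disjoint K (rangeF e)) {m₁ m₂ m₃ m₄ : ι'} (h₁ : m₁ ∉ rangeF e)
    (h₂ : m₂ ∉ rangeF e) (h₃ : m₃ ∉ rangeF e) (h₄ : m₄ ∉ rangeF e) :
    (frozenEmbed e K)ᴴ * (creation m₁ * creation m₃ * annihilation m₄ * annihilation m₂) * frozenEmbed e K =
      ((if m₃ = m₄ ∧ m₁ = m₂ ∧ m₁ ∈ K ∧ m₃ ∈ K then (1 : ℂ) else 0) -
        (if m₁ = m₄ ∧ m₃ = m₂ ∧ m₁ ∈ K ∧ m₃ ∈ K then (1 : ℂ) else 0)) •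
        (1 : Matrix (Finset ι) (Finset ι) ℂ) := by
  by_cases h12 : m₁ = m₂
  · subst h12
    by_cases h14 : m₁ = m₄
    · subst h14
      rw [Matrix.mul_assoc (creation m₁ * creation m₃), annihilation_mul_self', Matrix.mul_zero,
        Matrix.mul_zero, Matrix.zero_mul]
      by_cases h31 : m₃ = m₁
      · subst h31; simp
      · simp [h31]
    by_cases h13 : m₁ = m₃
    · subst h13
      rw [creation_mul_self, Matrix.zero_mul, Matrix.zero_mul, Matrix.mul_zero, Matrix.zero_mul,
        if_neg (show ¬(m₁ = m₄ ∧ m₁ = m₁ ∧ m₁ ∈ K ∧ m₁ ∈ K) from fun h => h14 h.1), sub_self, zero_smul]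
    -- the diagonal Coulomb case: the string is `n_{m₁} c†_{m₃} c_{m₄}`
    have hw : creation m₁ * creation m₃ * annihilation m₄ * annihilation m₁ =
        numberAt m₁ * (creation m₃ * annihilation m₄) := by
      rw [Matrix.mul_assoc (creation m₁ * creation m₃), annihilation_swap_eq_neg m₄ m₁,
        Matrix.mul_neg, ← Matrix.mul_assoc, Matrix.mul_assoc (creation m₁) (creation m₃),
        creation_annihilation_swap_eq_neg (Ne.symm h13), Matrix.mul_neg, Matrix.neg_mul, neg_neg,
        ← Matrix.mul_assoc (creation m₁), Matrix.mul_assoc (creation m₁ * annihilation m₁)]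
      rfl
    rw [hw, sandwich_creation_mul_annihilation e hK h₃ h₄ (numberAt_commute m₁ m₄),
      sandwich_numberAt e hK h₁]
    by_cases h34 : m₃ = m₄
    · subst h34
      by_cases h3K : m₃ ∈ K <;> by_cases h1K : m₁ ∈ K <;> simp [h3K, h1K, h14]
    · simp [h34, h14]
  · by_cases h42 : m₄ = m₂
    · rw [h42, Matrix.mul_assoc (creation m₁ * creation m₃), annihilation_mul_self', Matrix.mul_zero,
        Matrix.mul_zero, Matrix.zero_mul,
        if_neg (show ¬(m₃ = m₂ ∧ m₁ = m₂ ∧ m₁ ∈ K ∧ m₃ ∈ K) from fun h => h12 h.2.1),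
        if_neg (show ¬(m₁ = m₂ ∧ m₃ = m₂ ∧ m₁ ∈ K ∧ m₃ ∈ K) from fun h => h12 h.1), sub_self, zero_smul]
    -- the exchange case: `c†_{m₃} c_{m₄} = δ - c_{m₄} c†_{m₃}` splits the string
    have h34 : creation m₃ * annihilation m₄ =
        (if m₃ = m₄ then (1 : ℂ) else 0) • (1 : Matrix (Finset ι') (Finset ι') ℂ) -
          annihilation m₄ * creation m₃ := by
      rw [annihilation_mul_creation m₄ m₃]
      by_cases h : m₃ = m₄
      · subst h
        simp
      · simp [h, Ne.symm h]
    have hw : creation m₁ * creation m₃ * annihilation m₄ * annihilation m₂ =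
        (if m₃ = m₄ then (1 : ℂ) else 0) • (creation m₁ * annihilation m₂) -
          creation m₁ * annihilation m₄ * (creation m₃ * annihilation m₂) := by
      rw [Matrix.mul_assoc (creation m₁), h34, Matrix.mul_sub, Matrix.sub_mul, Matrix.mul_smul,
        Matrix.mul_one, Matrix.smul_mul, ← Matrix.mul_assoc (creation m₁),
        Matrix.mul_assoc (creation m₁ * annihilation m₄)]
    rw [hw, Matrix.mul_sub, Matrix.sub_mul, Matrix.mul_smul, Matrix.smul_mul, sandwichOne_EE e hK h₁ h₂,
      if_neg (show ¬(m₁ = m₂ ∧ m₁ ∈ K) from fun h => h12 h.1), smul_zero, zero_sub,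
      sandwich_creation_mul_annihilation e hK h₃ h₂
        ((commute_creation_numberAt_of_ne h12).mul_left (commute_annihilation_numberAt_of_ne h42)),
      sandwichOne_EE e hK h₁ h₄,
      if_neg (show ¬(m₃ = m₄ ∧ m₁ = m₂ ∧ m₁ ∈ K ∧ m₃ ∈ K) from fun h => h12 h.2.1), zero_sub]
    by_cases h32 : m₃ = m₂
    · subst h32
      by_cases h14 : m₁ = m₄
      · subst h14
        by_cases h3K : m₃ ∈ K <;> by_cases h1K : m₁ ∈ K <;> simp [h3K, h1K]
      · simp [h14]
    · simp [h32]

end Literature.MathematicalPhysics.QuantumLattice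

end
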